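import Mathlib
import HarnessLib
import Summits.HubbardSuperconductivity.HubbardSuperconductivity.Theses.LiebTwin
import Summits.HubbardSuperconductivity.HubbardSuperconductivity.Theorems.EnslavedA1gLowerSandwich
import Summits.HubbardSuperconductivity.HubbardSuperconductivity.Theorems.EnslavedA1gPairChemicalPotentialWindowLemmas
import Summits.HubbardSuperconductivity.HubbardSuperconductivity.Theorems.EnslavedA1gUpperSandwichRemovalWindow
import Literature.MathematicalPhysics.QuantumLattice.HubbardCommutatorBound
import Literature.MathematicalPhysics.QuantumLattice.SectorSpectrum
import Literature.MathematicalPhysics.QuantumLattice.HubbardModelParticleHoleProofs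
import Literature.MathematicalPhysics.QuantumLattice.ApproximateEigenvectorLemmas
import Literature.MathematicalPhysics.QuantumLattice.DWaveSourceProofs
import Summits.HubbardSuperconductivity.HubbardSuperconductivity.Theorems.BalabanIRBirEveryGroundStateAffine

/-!
# Crux `NoOnsiteODLRO` (stmt-HubbardSuperconductivity-0933), large-`U` shadow, part 1/3:
# the projected creation operator `c†_{xσ}(1 - n_{xσ̄})` — algebra and weights

Adding an electron into an EMPTY site creates no doublon: for `A_x := c†_{xτ} - c†_{xτ} n_{xτ'}`
(`τ' ≠ τ`) the Hubbard interaction commutes with `A_x`, so `[H(t,U), A_x] = [H(t,0), A_x]` has norm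
`≤ (2Δ+1)·8|t|` on a graph of maximal degree `Δ`, UNIFORMLY IN `U` (Hastings–Koma locality bound of the
tree, `norm_commutator_hamiltonianWith_le`). Moreover `A_xᴴ A_x = (1 - n_{xτ})(1 - n_{xτ'})` is the
projection "site `x` empty", whence the total weight of the trial vectors `A_x φ` over all sites is
`≥ (|Λ| - N) ‖φ‖²` on `N`-particle vectors. Part 2 averages these trial vectors (Ruelle/Tasaki
variational step) to bound the pair chemical potential `E(N) - E(N-2)` by `144|t|/√δ` at hole density
`δ`, uniformly in `U` and `L`; part 3 combines this strict window at `U > 144/√δ` with the landed lower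
sandwich to bound the on-site pair condensate density by `O(U⁻²)`. Essler–Frahm–Göhmann–Klümper–Korepin
(2005) §2.1 (CAR identities); Hastings–Koma, CMP 265 (2006) 781, App. A. All folklore bookkeeping.
-/

noncomputable section

namespace Summit.HubbardSuperconductivity.NoOnsiteODLRO.LargeU

open Matrix Finset
open Literature.Probability.LatticeModels Literature.MathematicalPhysics.QuantumLattice
open scoped ComplexOrder Matrix.Norms.L2Operator

/-! ### The projected creation operator `A_{xστ} = c†_{xσ} (1 - n_{xτ}) = c†_{xσ} - c†_{xσ} n_{xτ}` -/

section Algebra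

variable {Λ : Type*} [LinearOrder Λ] [Fintype Λ]

/-- **`[Σ_x n_{x↑}n_{x↓}, c†_{zτ}] = c†_{zτ} n_{zτ'}`** (`τ' ≠ τ`): creating an electron makes a
doublon exactly when the opposite spin is present. Essler et al. (2005) §2.1. [folklore] -/
theorem interaction_commutator_creation (z : Λ) {τ τ' : Fin 2} (hne : τ' ≠ τ) :
    (∑ x : Λ, numberOp x 0 * numberOp x 1) * creation (orb z τ) -
        creation (orb z τ) * ∑ x : Λ, numberOp x 0 * numberOp x 1 =
      creation (orb z τ) * numberOp z τ' := by
  have h := congrArg conjTranspose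
    (Summit.HubbardSuperconductivity.HubbardSuperconductivity.Theorems.EnslavedA1g.interaction_commutator_annihilation
      z hne)
  rw [conjTranspose_sub, conjTranspose_mul, conjTranspose_mul, conjTranspose_neg, conjTranspose_mul,
    Summit.HubbardSuperconductivity.HubbardSuperconductivity.Theorems.doublon_isHermitian, annihilation_conjTranspose,
    ← numberAt_orb,
    (numberAt_isHermitian _).eq, numberAt_orb] at h
  -- `h : c† I - I c† = -(c† n)`; rearrange
  rw [← neg_sub, h, neg_neg]

/-- `Σ_x n_{x↑}n_{x↓}` commutes with every `n_{zρ}`. [folklore] -/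
theorem interaction_mul_numberOp (z : Λ) (ρ : Fin 2) :
    (∑ x : Λ, numberOp x 0 * numberOp x 1) * numberOp z ρ =
      numberOp z ρ * ∑ x : Λ, numberOp x 0 * numberOp x 1 := by
  rw [Finset.sum_mul, Finset.mul_sum]
  refine Finset.sum_congr rfl fun x _ => ?_
  simp only [← numberAt_orb]
  rw [Matrix.mul_assoc, (numberAt_commute (orb x 1) (orb z ρ)).eq, ← Matrix.mul_assoc,
    (numberAt_commute (orb x 0) (orb z ρ)).eq, Matrix.mul_assoc]

/-- **The interaction commutes with the projected creation** `A = c†_{zτ} - c†_{zτ} n_{zτ'}`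
(`τ' ≠ τ`): adding an electron into a site with no opposite spin creates no doublon. [folklore] -/
theorem interaction_commute_projCreation (z : Λ) {τ τ' : Fin 2} (hne : τ' ≠ τ) :
    (∑ x : Λ, numberOp x 0 * numberOp x 1) *
        (creation (orb z τ) - creation (orb z τ) * numberOp z τ') =
      (creation (orb z τ) - creation (orb z τ) * numberOp z τ') *
        ∑ x : Λ, numberOp x 0 * numberOp x 1 := by
  set I : Matrix (Finset (Orb Λ)) (Finset (Orb Λ)) ℂ := ∑ x : Λ, numberOp x 0 * numberOp x 1 with hI
  set c : Matrix (Finset (Orb Λ)) (Finset (Orb Λ)) ℂ := creation (orb z τ) with hc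
  set n : Matrix (Finset (Orb Λ)) (Finset (Orb Λ)) ℂ := numberOp z τ' with hn
  have h1 : I * c = c * I + c * n := by
    have h := interaction_commutator_creation z hne
    rw [← hI, ← hc, ← hn] at h
    rw [← h]; abel
  have hIn : I * n = n * I := by rw [hI, hn]; exact interaction_mul_numberOp z τ'
  have hidem : n * n = n := by
    rw [hn, ← numberAt_orb]; exact numberAt_idempotent _
  calc I * (c - c * n) = I * c - I * c * n := by rw [Matrix.mul_sub, Matrix.mul_assoc]
    _ = (c * I + c * n) - (c * I + c * n) * n := by rw [h1]
    _ = c * I + c * n - (c * (I * n) + c * (n * n)) := by rw [Matrix.add_mul, Matrix.mul_assoc, Matrix.mul_assoc]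
    _ = c * I + c * n - (c * (n * I) + c * n) := by rw [hIn, hidem]
    _ = (c - c * n) * I := by rw [Matrix.sub_mul, Matrix.mul_assoc]; abel

/-- `[H(t,U), A] = [H(t,0), A]` for the projected creation `A` (`H(t,U) = H(t,0) + U·Σ n↑n↓`,
`hamiltonian_eq_add_smul_doublon`). [folklore] -/
theorem hamiltonian_commutator_projCreation (G : SimpleGraph Λ) [DecidableRel G.Adj] (t U : ℝ)
    (z : Λ) {τ τ' : Fin 2} (hne : τ' ≠ τ) :
    hamiltonian G t U * (creation (orb z τ) - creation (orb z τ) * numberOp z τ') -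
        (creation (orb z τ) - creation (orb z τ) * numberOp z τ') * hamiltonian G t U =
      hamiltonian G t 0 * (creation (orb z τ) - creation (orb z τ) * numberOp z τ') -
        (creation (orb z τ) - creation (orb z τ) * numberOp z τ') * hamiltonian G t 0 := by
  rw [Summit.HubbardSuperconductivity.HubbardSuperconductivity.Theorems.hamiltonian_eq_add_smul_doublon G t U, Matrix.add_mul, Matrix.mul_add, Matrix.smul_mul,
    Matrix.mul_smul, interaction_commute_projCreation z hne]
  abel

/-- The projected creation lies in the CAR algebra of the site `z`. [folklore] -/
theorem projCreation_mem_carSubalgebra (z : Λ) (τ τ' : Fin 2) :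
    (creation (orb z τ) - creation (orb z τ) * numberOp z τ' :
        Matrix (Finset (Orb Λ)) (Finset (Orb Λ)) ℂ) ∈ carSubalgebra (orbSet ({z} : Finset Λ)) := by
  have hc : ∀ ρ : Fin 2, (creation (orb z ρ) : Matrix (Finset (Orb Λ)) (Finset (Orb Λ)) ℂ) ∈
      carSubalgebra (orbSet ({z} : Finset Λ)) := fun ρ =>
    creation_mem_carSubalgebra (orb_mem_orbSet (Finset.mem_singleton_self z) ρ)
  have ha : ∀ ρ : Fin 2, (annihilation (orb z ρ) : Matrix (Finset (Orb Λ)) (Finset (Orb Λ)) ℂ) ∈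
      carSubalgebra (orbSet ({z} : Finset Λ)) := fun ρ =>
    annihilation_mem_carSubalgebra (orb_mem_orbSet (Finset.mem_singleton_self z) ρ)
  exact Subalgebra.sub_mem _ (hc τ) (Subalgebra.mul_mem _ (hc τ) (Subalgebra.mul_mem _ (hc τ') (ha τ')))

/-- `‖c†_{zτ} - c†_{zτ} n_{zτ'}‖ ≤ 2`. [folklore] -/
theorem norm_projCreation_le (z : Λ) (τ τ' : Fin 2) :
    ‖(creation (orb z τ) - creation (orb z τ) * numberOp z τ' :
        Matrix (Finset (Orb Λ)) (Finset (Orb Λ)) ℂ)‖ ≤ 2 := by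
  have hc := norm_creation_le_one (ι := Orb Λ) (orb z τ)
  have hc' := norm_creation_le_one (ι := Orb Λ) (orb z τ')
  have ha' := norm_annihilation_le_one (ι := Orb Λ) (orb z τ')
  have hn : ‖(numberOp z τ' : Matrix (Finset (Orb Λ)) (Finset (Orb Λ)) ℂ)‖ ≤ 1 := by
    rw [numberOp]
    exact (norm_mul_le _ _).trans (by nlinarith [norm_nonneg (creation (orb z τ') :
      Matrix (Finset (Orb Λ)) (Finset (Orb Λ)) ℂ)])
  calc ‖(creation (orb z τ) - creation (orb z τ) * numberOp z τ' : Matrix (Finset (Orb Λ)) (Finset (Orb Λ)) ℂ)‖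
      ≤ ‖(creation (orb z τ) : Matrix (Finset (Orb Λ)) (Finset (Orb Λ)) ℂ)‖ +
          ‖(creation (orb z τ) * numberOp z τ' : Matrix (Finset (Orb Λ)) (Finset (Orb Λ)) ℂ)‖ :=
        norm_sub_le _ _
    _ ≤ 1 + 1 * 1 := by
        refine add_le_add hc ((norm_mul_le _ _).trans ?_)
        exact mul_le_mul hc hn (norm_nonneg _) zero_le_one
    _ = 2 := by norm_num

/-- **`‖[H(t,U), A]‖ ≤ 72 (2Δ+1)/9 …`**: on a graph of maximal degree `≤ Δ`,
`‖[H(t,U), c†_{zτ}(1 - n_{zτ'})]‖ ≤ (2Δ+1) · 8|t|`, uniformly in `U` and in the volume. [folklore] -/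
theorem norm_commutator_hamiltonian_projCreation_le (G : SimpleGraph Λ) [DecidableRel G.Adj] {Δ : ℕ}
    (hΔ : ∀ x : Λ, (Finset.univ.filter fun y => G.Adj x y).card ≤ Δ) (t U : ℝ) (z : Λ)
    {τ τ' : Fin 2} (hne : τ' ≠ τ) :
    ‖hamiltonian G t U * (creation (orb z τ) - creation (orb z τ) * numberOp z τ') -
        (creation (orb z τ) - creation (orb z τ) * numberOp z τ') * hamiltonian G t U‖ ≤
      (2 * Δ + 1 : ℕ) * (8 * |t|) := by
  rw [hamiltonian_commutator_projCreation G t U z hne, ← hamiltonianWith_zero]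
  have h := norm_commutator_hamiltonianWith_le G hΔ t 0 0 (projCreation_mem_carSubalgebra z τ τ')
  rw [Finset.card_singleton, one_mul] at h
  refine h.trans ?_
  have h2 := norm_projCreation_le (Λ := Λ) z τ τ'
  have h0 : (0 : ℝ) ≤ ((2 * Δ + 1 : ℕ) : ℝ) := by positivity
  calc ((2 * Δ + 1 : ℕ) : ℝ) * (2 * (2 * |t| + |(0 : ℝ)| + 2 * |(0 : ℝ)|) *
        ‖(creation (orb z τ) - creation (orb z τ) * numberOp z τ' : Matrix (Finset (Orb Λ)) (Finset (Orb Λ)) ℂ)‖)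
      ≤ ((2 * Δ + 1 : ℕ) : ℝ) * (2 * (2 * |t| + |(0 : ℝ)| + 2 * |(0 : ℝ)|) * 2) := by
        refine mul_le_mul_of_nonneg_left (mul_le_mul_of_nonneg_left h2 (by positivity)) h0
    _ = ((2 * Δ + 1 : ℕ) : ℝ) * (8 * |t|) := by rw [abs_zero]; ring

end Algebra

/-! ### Weights of the trial vectors `A_x φ` -/

section Weights

variable {Λ : Type*} [LinearOrder Λ] [Fintype Λ]

/-- `Aᴴ A = 1 - n_{xτ} - n_{xτ'} + n_{x↑} n_{x↓}` for `A = c†_{xτ} - c†_{xτ} n_{xτ'}`, `τ' ≠ τ`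
(`c c† = 1 - n`, `n'² = n'`, `[n', c] = 0`): `AᴴA = (1 - n_{xτ})(1 - n_{xτ'})` is the projection
onto "site `x` empty". Essler et al. (2005) §2.1. [folklore] -/
theorem projCreation_conjTranspose_mul_self (x : Λ) {τ τ' : Fin 2} (hne : τ' ≠ τ) :
    (creation (orb x τ) - creation (orb x τ) * numberOp x τ')ᴴ *
        (creation (orb x τ) - creation (orb x τ) * numberOp x τ') =
      (1 - numberOp x τ - numberOp x τ' + numberOp x 0 * numberOp x 1 :
        Matrix (Finset (Orb Λ)) (Finset (Orb Λ)) ℂ) := by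
  set c : Matrix (Finset (Orb Λ)) (Finset (Orb Λ)) ℂ := annihilation (orb x τ) with hc
  set n : Matrix (Finset (Orb Λ)) (Finset (Orb Λ)) ℂ := numberOp x τ with hn
  set n' : Matrix (Finset (Orb Λ)) (Finset (Orb Λ)) ℂ := numberOp x τ' with hn'
  have hcr : (creation (orb x τ) : Matrix (Finset (Orb Λ)) (Finset (Orb Λ)) ℂ) = cᴴ := by
    rw [hc, annihilation_conjTranspose]
  have hn'h : n'ᴴ = n' := by rw [hn', ← numberAt_orb]; exact (numberAt_isHermitian _).eq
  have hne' : orb x τ ≠ orb x τ' := fun h => hne (orb_eq_orb_iff.1 h).2.symm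
  -- `c c† = 1 - n`
  have hcc : c * cᴴ = 1 - n := by
    rw [hc, annihilation_conjTranspose, annihilation_mul_creation, if_pos rfl, hn, numberOp]
  -- `n' c = c n'`, `n'² = n'`, `n n' = n' n`
  have hn'c : n' * c = c * n' := by
    rw [hn', hc]
    exact Summit.HubbardSuperconductivity.HubbardSuperconductivity.Theorems.EnslavedA1g.numberOp_mul_annihilation_of_ne
      hne'.symm
  have hidem : n' * n' = n' := by rw [hn', ← numberAt_orb]; exact numberAt_idempotent _
  have hnn' : n * n' = n' * n := by
    rw [hn, hn', ← numberAt_orb, ← numberAt_orb]; exact (numberAt_commute _ _).eq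
  have h01 : (numberOp x 0 * numberOp x 1 : Matrix (Finset (Orb Λ)) (Finset (Orb Λ)) ℂ) = n * n' := by
    rw [hn, hn', hnn']
    exact Summit.HubbardSuperconductivity.HubbardSuperconductivity.Theorems.EnslavedA1g.pairNumber_eq_of_ne x hne
  -- `n' (c c†) = (c c†) n'`
  have hn'cc : n' * (c * cᴴ) = c * cᴴ * n' := by
    rw [hcc, Matrix.mul_sub, Matrix.sub_mul, Matrix.mul_one, Matrix.one_mul, hnn']
  rw [hcr, conjTranspose_sub, conjTranspose_mul, conjTranspose_conjTranspose, hn'h, h01]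
  -- `(c - n' c)(cᴴ - cᴴ n') = c cᴴ - c cᴴ n' - n' c cᴴ + n' c cᴴ n'`
  have hexp : (c - n' * c) * (cᴴ - cᴴ * n') =
      c * cᴴ - c * cᴴ * n' - n' * (c * cᴴ) + n' * (c * cᴴ) * n' := by
    simp only [Matrix.sub_mul, Matrix.mul_sub, Matrix.mul_assoc]
    abel
  rw [hexp, hn'cc, Matrix.mul_assoc (c * cᴴ) n' n', hidem, hcc]
  simp only [Matrix.sub_mul, Matrix.one_mul]
  abel

/-- `n_{xτ} + n_{xτ'} = n_{x↑} + n_{x↓}` for `τ' ≠ τ`. [folklore] -/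
theorem numberOp_add_numberOp_of_ne (x : Λ) {τ τ' : Fin 2} (hne : τ' ≠ τ) :
    (numberOp x τ + numberOp x τ' : Matrix (Finset (Orb Λ)) (Finset (Orb Λ)) ℂ) =
      numberOp x 0 + numberOp x 1 := by
  fin_cases τ <;> fin_cases τ'
  · exact absurd rfl hne
  · rfl
  · exact add_comm _ _
  · exact absurd rfl hne

/-- `Re ⟨φ, n_{x↑} n_{x↓} φ⟩ ≥ 0` (`= ‖n_{x↓} c_{x↑} φ‖²`-type positivity: `n_{x↑}n_{x↓}` is an
orthogonal projection). [folklore] -/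
theorem re_star_dotProduct_pairNumber_mulVec_nonneg (x : Λ) (φ : Fock (Orb Λ)) :
    0 ≤ (star φ ⬝ᵥ ((numberOp x 0 * numberOp x 1) *ᵥ φ)).re := by
  have hcomm : (numberOp x 1 : Matrix (Finset (Orb Λ)) (Finset (Orb Λ)) ℂ) * annihilation (orb x 0) =
      annihilation (orb x 0) * numberOp x 1 :=
    Summit.HubbardSuperconductivity.HubbardSuperconductivity.Theorems.EnslavedA1g.numberOp_mul_annihilation_of_ne
      (fun h => absurd (orb_eq_orb_iff.1 h).2 Fin.zero_lt_one.ne')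
  have h1 : (numberOp x 0 * numberOp x 1 : Matrix (Finset (Orb Λ)) (Finset (Orb Λ)) ℂ) =
      creation (orb x 0) * (numberOp x 1 * annihilation (orb x 0)) := by
    rw [hcomm, ← Matrix.mul_assoc]
    rfl
  rw [h1, ← mulVec_mulVec, Summit.HubbardSuperconductivity.EnslavedA1g.star_dotProduct_mulVec_eq_conjTranspose,
    creation_conjTranspose, ← mulVec_mulVec]
  exact Summit.HubbardSuperconductivity.HubbardSuperconductivity.Theorems.EnslavedA1g.UpperSandwich.re_star_dotProduct_numberOp_mulVec_nonneg
    x 1 _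

/-- **Total weight of the projected additions.** For `φ` in the sector `(a, b)` and `τ' ≠ τ`:
`Σ_x ‖A_x φ‖² ≥ (|Λ| - (a + b)) ‖φ‖²`, `A_x = c†_{xτ} - c†_{xτ} n_{xτ'}` — the number of empty sites is
at least `|Λ| - N`. [folklore] -/
theorem sum_weight_projCreation_ge {a b : ℕ} {φ : Fock (Orb Λ)} (hφ : IsInSector a b φ)
    {τ τ' : Fin 2} (hne : τ' ≠ τ) :
    ((Fintype.card Λ : ℝ) - (a + b)) * (star φ ⬝ᵥ φ).re ≤
      ∑ x : Λ, (star ((creation (orb x τ) - creation (orb x τ) * numberOp x τ') *ᵥ φ) ⬝ᵥ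
        ((creation (orb x τ) - creation (orb x τ) * numberOp x τ') *ᵥ φ)).re := by
  -- each summand is `Re ⟨φ, AᴴA φ⟩ = ‖φ‖² - Re⟨φ,n_τ φ⟩ - Re⟨φ,n_τ' φ⟩ + Re⟨φ, n↑n↓ φ⟩`
  have hterm : ∀ x : Λ,
      (star ((creation (orb x τ) - creation (orb x τ) * numberOp x τ') *ᵥ φ) ⬝ᵥ
        ((creation (orb x τ) - creation (orb x τ) * numberOp x τ') *ᵥ φ)).re =
      (star φ ⬝ᵥ φ).re - (star φ ⬝ᵥ ((numberOp x 0 + numberOp x 1) *ᵥ φ)).re +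
        (star φ ⬝ᵥ ((numberOp x 0 * numberOp x 1) *ᵥ φ)).re := by
    intro x
    rw [← PosSemidefTrace.expect_conjTranspose_mul, projCreation_conjTranspose_mul_self x hne]
    simp only [Literature.MathematicalPhysics.QuantumLattice.expect]
    rw [add_mulVec, sub_mulVec, sub_mulVec, one_mulVec, dotProduct_add, dotProduct_sub, dotProduct_sub,
      Complex.add_re, Complex.sub_re, Complex.sub_re, ← numberOp_add_numberOp_of_ne x hne, add_mulVec,
      dotProduct_add, Complex.add_re]
    ring
  simp only [hterm, Finset.sum_add_distrib, Finset.sum_sub_distrib, Finset.sum_const, Finset.card_univ,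
    nsmul_eq_mul]
  -- `Σ_x Re⟨φ,(n_{x↑}+n_{x↓})φ⟩ = (a + b) ‖φ‖²`
  have hN : ∑ x : Λ, (star φ ⬝ᵥ ((numberOp x 0 + numberOp x 1) *ᵥ φ)).re = (a + b) * (star φ ⬝ᵥ φ).re := by
    have h := totalNumber_mulVec_of_isNParticle hφ.isNParticle
    have h2 : (totalNumber : Matrix (Finset (Orb Λ)) (Finset (Orb Λ)) ℂ) =
        ∑ x : Λ, (numberOp x 0 + numberOp x 1) := by
      simp only [totalNumber, Fin.sum_univ_two]
    rw [h2, Matrix.sum_mulVec] at h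
    have h3 := congrArg (fun v => (star φ ⬝ᵥ v).re) h
    simp only [dotProduct_sum, Complex.re_sum, dotProduct_smul, smul_eq_mul] at h3
    rw [h3]
    push_cast
    simp [Complex.mul_re]
  have hI : 0 ≤ ∑ x : Λ, (star φ ⬝ᵥ ((numberOp x 0 * numberOp x 1) *ᵥ φ)).re :=
    Finset.sum_nonneg fun x _ => re_star_dotProduct_pairNumber_mulVec_nonneg x φ
  rw [hN]
  nlinarith

end Weights

/-- REGISTERED SUB-GOAL `stub_emptySiteWeight` (crux stmt-HubbardSuperconductivity-0933): on the torus
`(ℤ/Lℤ)²`, the total weight of the projected up-additions `c†_{x↑}(1-n_{x↓})φ` over all sites is at least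
`(L² - N)‖φ‖²` for `φ` in the sector `(a, b)`, `N = a + b` (`sum_weight_projCreation_ge`). [folklore] -/
theorem stub_emptySiteWeight : ∀ (L : ℕ) [NeZero L] (a b : ℕ) (φ : Fock (Orb (FermionTorus 2 L))), IsInSector a b φ → ((L : ℝ) ^ 2 - (a + b)) * (star φ ⬝ᵥ φ).re ≤ ∑ x : FermionTorus 2 L, (star ((creation (orb x 0) - creation (orb x 0) * numberOp x 1) *ᵥ φ) ⬝ᵥ ((creation (orb x 0) - creation (orb x 0) * numberOp x 1) *ᵥ φ)).re := by
  intro L _ a b φ hφ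
  have h := sum_weight_projCreation_ge hφ (τ := 0) (τ' := 1) (by decide)
  rwa [card_fermionTorus 2 L, Nat.cast_pow] at h

end Summit.HubbardSuperconductivity.NoOnsiteODLRO.LargeU

end
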